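import Literature.Analysis.FluidPDE.Antidivergence
import Literature.Analysis.FunctionSpaces.TorusInverseLaplacianCalculus
import HarnessLib

/-!
# Linearity of the De Lellis–Székelyhidi antidivergence `ℛ` on smooth fields

Analysis/FluidPDE support file. The accepted `Torus.antidivergence` (`Antidivergence.lean`:
`(ℛv)ᵢⱼ = ∂ᵢuⱼ + ∂ⱼuᵢ - (1/(d-1)) δᵢⱼ div u + ((2-d)/(d-1)) ∂ᵢ∂ⱼΔ⁻¹ div u`, `u = Δ⁻¹v`,
Cheskidov–Luo 2022, Def. 7.2; De Lellis–Székelyhidi 2013, §4.1) is an honest operator on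
functions, built from the honest inverse Laplacian `Torus.invLaplacian` and the partial
derivatives `Torus.partialDeriv`; both are additive and homogeneous on *smooth* arguments
(`Torus.invLaplacian_add`, `Torus.invLaplacian_const_smul`, `Torus.partialDeriv_add`,
`Torus.partialDeriv_const_smul`), but not unconditionally (junk values of `fderiv`). This file
records the resulting linearity of `ℛ` on smooth vector fields, which every use of `ℛ` on a sum
relies on — e.g. the split (5.23) of the new Reynolds stress of Buckmaster–De Lellis–
Székelyhidi–Vicol 2019 into Nash, transport and oscillation errors, and its mode-by-mode
estimates in §6.1 ("`ℛ(w_{q+1}·∇v̄_q) = Σ_i Σ_{k≠0} ℛ(…)`"):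

* `Torus.antidivPotential_add/_const_smul`, `Torus.antidivDiv_add/_const_smul`,
  `Torus.antidivPhi_add/_const_smul`, `Torus.antidivEntry_add/_const_smul` (the building blocks);
* `Torus.antidivergence_add` (`ℛ(v + w) = ℛv + ℛw`), `Torus.antidivergence_const_smul`
  (`ℛ(c • v) = c • ℛv`), `Torus.antidivergence_zero`, `_neg`, `_sub`, `_finset_sum`, with
  pointwise (`_apply`) forms.

## References

* C. De Lellis, L. Székelyhidi Jr., *Dissipative continuous Euler flows*, Invent. Math. 193
  (2013), §4.1 (the linear operator `ℛ`). [`DeLellisSzekelyhidiInvent2013`]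
* A. Cheskidov, X. Luo, *Sharp nonuniqueness for the Navier–Stokes equations*, Invent. Math. 229
  (2022), §7.2 Def. 7.2. [`CheskidovLuo2022`]
* T. Buckmaster, C. De Lellis, L. Székelyhidi Jr., V. Vicol, *Onsager's conjecture for admissible
  weak solutions*, CPAM 72 (2019), §5.4 (5.23), §6.1 (consumers).
-/

noncomputable section

open MeasureTheory Set Function
open scoped ContDiff

namespace Literature.Analysis.FluidPDE

namespace Torus

open FunctionSpaces FunctionSpaces.Torus

variable {d : Type*} [Fintype d] [DecidableEq d]
variable {v w : UnitAddTorus d → EuclideanSpace ℝ d}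

/-! ## Additivity -/

section Add

/-- `Δ⁻¹` of the components is additive: `u_j(v + w) = u_j(v) + u_j(w)`. [folklore] -/
theorem antidivPotential_add (hv : IsSmooth v) (hw : IsSmooth w) (j : d) :
    antidivPotential (v + w) j = antidivPotential v j + antidivPotential w j := by
  unfold antidivPotential
  have h : (fun x => (v + w) x j) = (fun x => v x j) + fun x => w x j := by
    funext x
    simp
  rw [h, invLaplacian_add (hv.apply j) (hw.apply j)]

/-- `div Δ⁻¹` is additive on smooth fields. [folklore] -/
theorem antidivDiv_add (hv : IsSmooth v) (hw : IsSmooth w) :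
    antidivDiv (v + w) = antidivDiv v + antidivDiv w := by
  funext x
  simp only [antidivDiv, Pi.add_apply, ← Finset.sum_add_distrib]
  refine Finset.sum_congr rfl fun l _ => ?_
  rw [antidivPotential_add hv hw l,
    partialDeriv_add ((isSmooth_antidivPotential hv l).isContDiff (by simp))
      ((isSmooth_antidivPotential hw l).isContDiff (by simp)) l, Pi.add_apply]

/-- `Δ⁻¹ div Δ⁻¹` is additive on smooth fields. [folklore] -/
theorem antidivPhi_add (hv : IsSmooth v) (hw : IsSmooth w) :
    antidivPhi (v + w) = antidivPhi v + antidivPhi w := by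
  unfold antidivPhi
  rw [antidivDiv_add hv hw, invLaplacian_add (isSmooth_antidivDiv hv) (isSmooth_antidivDiv hw)]

/-- The entries of `ℛ` are additive on smooth fields. [folklore] -/
theorem antidivEntry_add (hv : IsSmooth v) (hw : IsSmooth w) (i j : d) (x : UnitAddTorus d) :
    antidivEntry (v + w) i j x = antidivEntry v i j x + antidivEntry w i j x := by
  have hP : ∀ k l : d, partialDeriv k (antidivPotential (v + w) l) x =
      partialDeriv k (antidivPotential v l) x + partialDeriv k (antidivPotential w l) x := by
    intro k l
    rw [antidivPotential_add hv hw l,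
      partialDeriv_add ((isSmooth_antidivPotential hv l).isContDiff (by simp))
        ((isSmooth_antidivPotential hw l).isContDiff (by simp)) k, Pi.add_apply]
  have hD : antidivDiv (v + w) x = antidivDiv v x + antidivDiv w x := by
    rw [antidivDiv_add hv hw, Pi.add_apply]
  have hΦ : partialDeriv i (partialDeriv j (antidivPhi (v + w))) x =
      partialDeriv i (partialDeriv j (antidivPhi v)) x +
        partialDeriv i (partialDeriv j (antidivPhi w)) x := by
    rw [antidivPhi_add hv hw,
      partialDeriv_add ((isSmooth_antidivPhi hv).isContDiff (by simp))
        ((isSmooth_antidivPhi hw).isContDiff (by simp)) j,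
      partialDeriv_add (((isSmooth_antidivPhi hv).partialDeriv j).isContDiff (by simp))
        (((isSmooth_antidivPhi hw).partialDeriv j).isContDiff (by simp)) i, Pi.add_apply]
  simp only [antidivEntry, hP, hD, hΦ]
  split_ifs <;> ring

/-- **`ℛ` is additive on smooth vector fields**: `ℛ(v + w) = ℛv + ℛw` (`ℛ` is a linear
operator, De Lellis–Székelyhidi 2013, §4.1; here for the honest `Torus.antidivergence` on smooth
arguments, where `Δ⁻¹` and `∂ᵢ` are additive). [folklore] -/
theorem antidivergence_add (hv : IsSmooth v) (hw : IsSmooth w) :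
    antidivergence (v + w) = antidivergence v + antidivergence w := by
  funext x j
  rw [Pi.add_apply, Pi.add_apply, antidivergence, antidivergence, antidivergence, ← WithLp.toLp_add]
  congr 1
  funext i
  exact antidivEntry_add hv hw i j x

/-- Pointwise form of `Torus.antidivergence_add`. [folklore] -/
theorem antidivergence_add_apply (hv : IsSmooth v) (hw : IsSmooth w) (x : UnitAddTorus d) :
    antidivergence (fun y => v y + w y) x = antidivergence v x + antidivergence w x := by
  have h := congr_fun (antidivergence_add hv hw) x
  rwa [Pi.add_apply] at h

end Add

/-! ## Homogeneity -/

section Smul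

omit [DecidableEq d] in
/-- `Δ⁻¹` of the components is homogeneous: `u_j(c • v) = c • u_j(v)`. [folklore] -/
theorem antidivPotential_const_smul (hv : IsSmooth v) (c : ℝ) (j : d) :
    antidivPotential (c • v) j = c • antidivPotential v j := by
  unfold antidivPotential
  have h : (fun x => (c • v) x j) = c • fun x => v x j := by
    funext x
    simp
  rw [h, invLaplacian_const_smul c _ (hv.apply j)]

/-- `div Δ⁻¹` is homogeneous on smooth fields. [folklore] -/
theorem antidivDiv_const_smul (hv : IsSmooth v) (c : ℝ) :
    antidivDiv (c • v) = c • antidivDiv v := by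
  funext x
  simp only [antidivDiv, Pi.smul_apply, Finset.smul_sum]
  refine Finset.sum_congr rfl fun l _ => ?_
  rw [antidivPotential_const_smul hv c l,
    partialDeriv_const_smul ((isSmooth_antidivPotential hv l).isContDiff (by simp)) c l,
    Pi.smul_apply]

/-- `Δ⁻¹ div Δ⁻¹` is homogeneous on smooth fields. [folklore] -/
theorem antidivPhi_const_smul (hv : IsSmooth v) (c : ℝ) :
    antidivPhi (c • v) = c • antidivPhi v := by
  unfold antidivPhi
  rw [antidivDiv_const_smul hv c, invLaplacian_const_smul c _ (isSmooth_antidivDiv hv)]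

/-- The entries of `ℛ` are homogeneous on smooth fields. [folklore] -/
theorem antidivEntry_const_smul (hv : IsSmooth v) (c : ℝ) (i j : d) (x : UnitAddTorus d) :
    antidivEntry (c • v) i j x = c * antidivEntry v i j x := by
  have hP : ∀ k l : d, partialDeriv k (antidivPotential (c • v) l) x =
      c * partialDeriv k (antidivPotential v l) x := by
    intro k l
    rw [antidivPotential_const_smul hv c l,
      partialDeriv_const_smul ((isSmooth_antidivPotential hv l).isContDiff (by simp)) c k,
      Pi.smul_apply, smul_eq_mul]
  have hD : antidivDiv (c • v) x = c * antidivDiv v x := by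
    rw [antidivDiv_const_smul hv c, Pi.smul_apply, smul_eq_mul]
  have hΦ : partialDeriv i (partialDeriv j (antidivPhi (c • v))) x =
      c * partialDeriv i (partialDeriv j (antidivPhi v)) x := by
    rw [antidivPhi_const_smul hv c,
      partialDeriv_const_smul ((isSmooth_antidivPhi hv).isContDiff (by simp)) c j,
      partialDeriv_const_smul (((isSmooth_antidivPhi hv).partialDeriv j).isContDiff (by simp)) c i,
      Pi.smul_apply, smul_eq_mul]
  simp only [antidivEntry, hP, hD, hΦ]
  split_ifs <;> ring

/-- **`ℛ` is homogeneous on smooth vector fields**: `ℛ(c • v) = c • ℛv`. [folklore] -/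
theorem antidivergence_const_smul (hv : IsSmooth v) (c : ℝ) :
    antidivergence (c • v) = c • antidivergence v := by
  funext x j
  rw [Pi.smul_apply, Pi.smul_apply, antidivergence, antidivergence, ← WithLp.toLp_smul]
  congr 1
  funext i
  rw [Pi.smul_apply, smul_eq_mul]
  exact antidivEntry_const_smul hv c i j x

/-- Pointwise form of `Torus.antidivergence_const_smul`. [folklore] -/
theorem antidivergence_const_smul_apply (hv : IsSmooth v) (c : ℝ) (x : UnitAddTorus d) :
    antidivergence (fun y => c • v y) x = c • antidivergence v x := by
  have h := congr_fun (antidivergence_const_smul hv c) x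
  rwa [Pi.smul_apply] at h

end Smul

/-! ## Consequences: zero, negation, differences, finite sums -/

section Consequences

/-- `ℛ 0 = 0`. [folklore] -/
theorem antidivergence_zero :
    antidivergence (0 : UnitAddTorus d → EuclideanSpace ℝ d) = 0 := by
  have h0 : IsSmooth (0 : UnitAddTorus d → EuclideanSpace ℝ d) := isSmooth_const _
  calc antidivergence (0 : UnitAddTorus d → EuclideanSpace ℝ d)
      = antidivergence ((0 : ℝ) • (0 : UnitAddTorus d → EuclideanSpace ℝ d)) := by rw [zero_smul]
    _ = (0 : ℝ) • antidivergence 0 := antidivergence_const_smul h0 0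
    _ = 0 := zero_smul _ _

/-- `ℛ(-v) = -ℛv` for smooth `v`. [folklore] -/
theorem antidivergence_neg (hv : IsSmooth v) : antidivergence (-v) = -antidivergence v := by
  rw [← neg_one_smul ℝ v, antidivergence_const_smul hv, neg_one_smul]

/-- `ℛ(v - w) = ℛv - ℛw` for smooth `v, w`. [folklore] -/
theorem antidivergence_sub (hv : IsSmooth v) (hw : IsSmooth w) :
    antidivergence (v - w) = antidivergence v - antidivergence w := by
  rw [sub_eq_add_neg, antidivergence_add hv hw.neg, antidivergence_neg hw, sub_eq_add_neg]

/-- Pointwise form of `Torus.antidivergence_sub`. [folklore] -/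
theorem antidivergence_sub_apply (hv : IsSmooth v) (hw : IsSmooth w) (x : UnitAddTorus d) :
    antidivergence (fun y => v y - w y) x = antidivergence v x - antidivergence w x := by
  have h := congr_fun (antidivergence_sub hv hw) x
  rwa [Pi.sub_apply] at h

/-- **`ℛ` of a finite sum of smooth fields** is the sum of the `ℛ`'s (pointwise form).
[folklore] -/
theorem antidivergence_finset_sum_apply {ι : Type*} (s : Finset ι)
    {f : ι → UnitAddTorus d → EuclideanSpace ℝ d} (hf : ∀ l ∈ s, IsSmooth (f l))
    (x : UnitAddTorus d) :
    antidivergence (fun y => ∑ l ∈ s, f l y) x = ∑ l ∈ s, antidivergence (f l) x := by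
  classical
  induction s using Finset.induction_on with
  | empty =>
    simp only [Finset.sum_empty]
    rw [show (fun y : UnitAddTorus d => (0 : EuclideanSpace ℝ d)) = 0 from rfl, antidivergence_zero]
    rfl
  | insert a s ha ih =>
    have hs : ∀ l ∈ s, IsSmooth (f l) := fun l hl => hf l (Finset.mem_insert_of_mem hl)
    have hsum : IsSmooth (fun y => ∑ l ∈ s, f l y) := isSmooth_finset_sum s hs
    have heq : (fun y => ∑ l ∈ insert a s, f l y) = fun y => f a y + ∑ l ∈ s, f l y := by
      funext y
      rw [Finset.sum_insert ha]
    rw [heq, Finset.sum_insert ha, antidivergence_add_apply (hf a (Finset.mem_insert_self a s)) hsum,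
      ih hs]

/-- `ℛ` of a finite sum of smooth fields (function form). [folklore] -/
theorem antidivergence_finset_sum {ι : Type*} (s : Finset ι)
    {f : ι → UnitAddTorus d → EuclideanSpace ℝ d} (hf : ∀ l ∈ s, IsSmooth (f l)) :
    antidivergence (∑ l ∈ s, f l) = ∑ l ∈ s, antidivergence (f l) := by
  funext x
  rw [Finset.sum_apply, show (∑ l ∈ s, f l) = fun y => ∑ l ∈ s, f l y from
    funext fun y => Finset.sum_apply y s f, antidivergence_finset_sum_apply s hf x]

end Consequences

end Torus

end Literature.Analysis.FluidPDE
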